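import Mathlib.Analysis.Complex.Basic
import Mathlib.SetTheory.Cardinal.Order
import HarnessLib

/-!
# F0 · P3c · line LH6 «StCharTS» — BRICK «REGROUP-ALG» for (R) «Sa-REGROUP★»: the finite re-grouping algebra of [Rogawski1990, L. 12.7.2, proof pp. 192–193]
# («we can re-write `b(π)Tr π + b(π^{nt})Tr π^{nt}` as `Tr(i_G(χ)(f))`», (12.7.1)), as pure algebra over abstract index types

Cell `pub/hodgecm-mathlib`, crux H413 = `stmt-HodgeConjecture-24833` (`--supports` lane, helper), route HCCMUnconditional; seat LH6-p01 (g0); desk F0P3b-plan (g23) deal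
(R) «Sa-REGROUP★» (interface v2 final `F0/P3b/LH6-p01/g0/SaRegroup.interface.v2final.txt`).  THEOREMS ONLY, Mathlib-only, sorry-free, no definition ∕ instance ∕ notation ∕
named fact.  HONEST LABEL: HC_CM is proved only modulo the 7 printed citations (2 remaining: hLiu418 = stmt-HodgeConjecture-24832, h413 = stmt-HodgeConjecture-24833) until
rung 0 closes; count-neutral algebra.

THE MATHEMATICS.  In the proof of L. 12.7.2 the members `X = supp a` of the (β)-identity `Σ a(π) Tr π(f) = Tr ρ(f^H)` are split into the square-integrable ones and
the others; each non-square-integrable member is (§12.2) an irreducible principal series `i_G(χ)` (kind 1: `Tr π = Tr i_G(χ)`), or the non-`L²` constituent of a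
length-two `i_G(χ)` whose other constituent IS `L²` (kind 2: `πⁿ(ξ)` with `π²(ξ)`, `ψ∘det` with `St_G(ψ)`: `Tr π + Tr π̂ = Tr i_G(χ)`), or a member of an l.d.s. packet
`{π′, π″}` (kind 3: `Tr π′ + Tr π″ = Tr i_G(θ̃)`, and `a(π′) = a(π″)` by the (γ)-step ★ `F0P3cStCharTSSaL2.ldsCoeff_eq`).  Re-grouping gives print's (12.7.1):
`Σ a(π)Tr π = Σ_{L²} b(σ) Tr σ + Σ_χ d(χ) Tr i_G(χ)` with `b(σ) = a(σ) − a(u)` for the kind-2 unit `u` whose mate is `σ` (`b = a` at the other `L²` classes, `b = 0` off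
`L²`) and `d(par u) = a(u)` at every ORIENTED unit `u` (kinds 1, 2, and one chosen member of each l.d.s. pair).  At a fixed test function only finitely many terms are
non-zero (level finiteness), so (12.7.1) is a FINITE rearrangement — this file proves exactly that rearrangement over abstract index types `I` (classes) and `Λ`
(parameters), the traces at the fixed test function being arbitrary functions `T : I → ℂ` (classes), `P : Λ → ℂ` (principal series):
* §1 `regroup_sum_eq` — `Σ_{i∈E} a_i T_i = Σ_{i∈E} b_i T_i + Σ_{λ ∈ par(E ∩ O)} d_λ P_λ` for every finite `E` closed under the kind-2∕3 mates;
* §2 `exists_closed_finset` — every finite set of classes is contained in such a closed finite `E` (so the per-test-function supports can be enclosed);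
* §3 `exists_coeffs` — the coefficients `b`, `d` with their read-outs; `exists_orientation` — one member of each l.d.s. pair can be chosen coherently.

## References
* [Rogawski1990] J. D. Rogawski, *Automorphic Representations of Unitary Groups in Three Variables*, Ann. of Math. Stud. 123 (1990): §12.7 Lemma 12.7.2 (proof)
  pp. 192–193 ((12.7.1)); §12.2 pp. 173–174.
-/

set_option autoImplicit false
-- the mandated namespace has the single-problem summit's repeated segment (`HodgeConjecture.HodgeConjecture`)
set_option linter.dupNamespace false

open scoped BigOperators

namespace Summit.HodgeConjecture.HodgeConjecture.Cruxes.H413.F0P3cStCharTSRegroupAlg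

variable {I Λ : Type*}

/-! ## §1 The finite re-grouping identity (12.7.1) -/

/-- **(12.7.1) as a finite rearrangement.**  Global data: coefficients `aX`, the predicate `L2` («square-integrable»), three pairwise disjoint sets of non-`L2`
UNITS — `U₁` (kind 1: `T u = P(par u)`), `U₂` (kind 2: an `L2` mate `m u`, `m` injective on `U₂`, `T u + T(m u) = P(par u)`), `U₃` (kind 3, l.d.s.: an involutive
fixed-point-free mate inside `U₃` with the same parameter and the same coefficient, `T u + T(m u) = P(par u)`, and an orientation `rep` holding at exactly one of
`u, m u`) — a parameter map `par` injective on the oriented units `O = U₁ ∪ U₂ ∪ {u ∈ U₃ | rep u}`, and the re-grouped coefficients `b` (`= 0` off `L2`, `= a σ − a u`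
at the mate `σ = m u` of a kind-2 unit, `= a σ` at the other `L2` classes) and `d` (`d(par u) = a u` on `O`).  Then for every finite `E` closed under the kind-2 mates in
both directions and under the kind-3 mates, whose non-`L2` members with `a ≠ 0` are units:
`Σ_{i∈E} a_i T_i = Σ_{i∈E} b_i T_i + Σ_{λ ∈ par(E ∩ O)} d_λ P_λ`. [cite: Rogawski1990, §12.7 Lemma 12.7.2 (proof) pp. 192–193] -/
theorem regroup_sum_eq [DecidableEq I] [DecidableEq Λ] (aX b : I → ℤ) (d : Λ → ℤ) (L2 : I → Prop) (U₁ U₂ U₃ : Set I) (m : I → I) (par : I → Λ)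
    (rep : I → Prop) [DecidablePred L2] [DecidablePred (· ∈ U₁)] [DecidablePred (· ∈ U₂)] [DecidablePred (· ∈ U₃)] [DecidablePred rep]
    (hU₁ : ∀ u ∈ U₁, ¬ L2 u) (hU₂ : ∀ u ∈ U₂, ¬ L2 u ∧ L2 (m u))
    (hU₃ : ∀ u ∈ U₃, ¬ L2 u ∧ m u ∈ U₃ ∧ m (m u) = u ∧ m u ≠ u ∧ par (m u) = par u ∧ aX (m u) = aX u ∧ (rep u ↔ ¬ rep (m u)))
    (h12 : ∀ u ∈ U₁, u ∉ U₂) (h13 : ∀ u ∈ U₁, u ∉ U₃) (h23 : ∀ u ∈ U₂, u ∉ U₃) (hm : Set.InjOn m U₂)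
    (hpar : Set.InjOn par {u | u ∈ U₁ ∨ u ∈ U₂ ∨ (u ∈ U₃ ∧ rep u)})
    (hbL : ∀ i, ¬ L2 i → b i = 0) (hb₂ : ∀ u ∈ U₂, b (m u) = aX (m u) - aX u) (hb₀ : ∀ i, L2 i → (∀ u ∈ U₂, m u ≠ i) → b i = aX i)
    (hd : ∀ u, (u ∈ U₁ ∨ u ∈ U₂ ∨ (u ∈ U₃ ∧ rep u)) → d (par u) = aX u)
    (T : I → ℂ) (P : Λ → ℂ) (hT₁ : ∀ u ∈ U₁, T u = P (par u)) (hT₂ : ∀ u ∈ U₂, T u + T (m u) = P (par u))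
    (hT₃ : ∀ u ∈ U₃, T u + T (m u) = P (par u))
    (E : Finset I) (hEm₂ : ∀ u ∈ U₂, u ∈ E ↔ m u ∈ E) (hEm₃ : ∀ u ∈ U₃, u ∈ E → m u ∈ E)
    (hEcl : ∀ i ∈ E, ¬ L2 i → aX i ≠ 0 → i ∈ U₁ ∨ i ∈ U₂ ∨ i ∈ U₃) :
    ∑ i ∈ E, (aX i : ℂ) * T i =
      ∑ i ∈ E, (b i : ℂ) * T i + ∑ lam ∈ (E.filter fun u => u ∈ U₁ ∨ u ∈ U₂ ∨ (u ∈ U₃ ∧ rep u)).image par, (d lam : ℂ) * P lam := by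
  classical
  -- the pieces of `E`
  set EL : Finset I := E.filter fun i => L2 i with hEL
  set E₁ : Finset I := E.filter fun u => u ∈ U₁ with hE₁
  set E₂ : Finset I := E.filter fun u => u ∈ U₂ with hE₂
  set E₃r : Finset I := E.filter fun u => u ∈ U₃ ∧ rep u with hE₃r
  set E₃n : Finset I := E.filter fun u => u ∈ U₃ ∧ ¬ rep u with hE₃n
  set EO : Finset I := E.filter fun u => u ∈ U₁ ∨ u ∈ U₂ ∨ (u ∈ U₃ ∧ rep u) with hEO
  -- (0) a sum over `E` of a function vanishing at the non-`L2` non-units splits along `EL, E₁, E₂, E₃r, E₃n`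
  have hsplit : ∀ f : I → ℂ, (∀ i ∈ E, ¬ L2 i → ¬ (i ∈ U₁ ∨ i ∈ U₂ ∨ i ∈ U₃) → f i = 0) →
      ∑ i ∈ E, f i = ∑ i ∈ EL, f i + (∑ i ∈ E₁, f i + ∑ i ∈ E₂, f i + (∑ i ∈ E₃r, f i + ∑ i ∈ E₃n, f i)) := by
    intro f hf0
    rw [← Finset.sum_filter_add_sum_filter_not E (fun i => L2 i)]
    congr 1
    have hnL : ∑ i ∈ E.filter (fun i => ¬ L2 i), f i = ∑ i ∈ (E.filter fun i => ¬ L2 i).filter (fun i => i ∈ U₁ ∨ i ∈ U₂ ∨ i ∈ U₃), f i := by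
      symm
      apply Finset.sum_filter_of_ne
      intro i hi hfi
      rw [Finset.mem_filter] at hi
      by_contra hn
      exact hfi (hf0 i hi.1 hi.2 hn)
    have hK : (E.filter fun i => ¬ L2 i).filter (fun i => i ∈ U₁ ∨ i ∈ U₂ ∨ i ∈ U₃) = (E₁ ∪ E₂) ∪ (E₃r ∪ E₃n) := by
      ext i
      simp only [Finset.mem_filter, Finset.mem_union, hE₁, hE₂, hE₃r, hE₃n]
      constructor
      · rintro ⟨⟨hi, -⟩, h | h | h⟩
        · exact Or.inl (Or.inl ⟨hi, h⟩)
        · exact Or.inl (Or.inr ⟨hi, h⟩)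
        · by_cases hr : rep i
          · exact Or.inr (Or.inl ⟨hi, h, hr⟩)
          · exact Or.inr (Or.inr ⟨hi, h, hr⟩)
      · rintro ((⟨hi, h⟩ | ⟨hi, h⟩) | (⟨hi, h, -⟩ | ⟨hi, h, -⟩))
        · exact ⟨⟨hi, hU₁ i h⟩, Or.inl h⟩
        · exact ⟨⟨hi, (hU₂ i h).1⟩, Or.inr (Or.inl h)⟩
        · exact ⟨⟨hi, (hU₃ i h).1⟩, Or.inr (Or.inr h)⟩
        · exact ⟨⟨hi, (hU₃ i h).1⟩, Or.inr (Or.inr h)⟩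
    have hd12 : Disjoint E₁ E₂ := Finset.disjoint_filter.2 fun i _ h1 h2 => h12 i h1 h2
    have hd3 : Disjoint E₃r E₃n := Finset.disjoint_filter.2 fun i _ h1 h2 => h2.2 h1.2
    have hd123 : Disjoint (E₁ ∪ E₂) (E₃r ∪ E₃n) := by
      rw [Finset.disjoint_union_left, Finset.disjoint_union_right, Finset.disjoint_union_right]
      exact ⟨⟨Finset.disjoint_filter.2 fun i _ h1 h3 => h13 i h1 h3.1, Finset.disjoint_filter.2 fun i _ h1 h3 => h13 i h1 h3.1⟩,
        ⟨Finset.disjoint_filter.2 fun i _ h2 h3 => h23 i h2 h3.1, Finset.disjoint_filter.2 fun i _ h2 h3 => h23 i h2 h3.1⟩⟩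
    rw [hnL, hK, Finset.sum_union hd123, Finset.sum_union hd12, Finset.sum_union hd3]
  -- (1) the left-hand side, split
  have hLHS := hsplit (fun i => (aX i : ℂ) * T i) fun i hi hL hn => by
    have : aX i = 0 := by
      by_contra h
      exact hn (hEcl i hi hL h)
    rw [this, Int.cast_zero, zero_mul]
  -- (2) the `b`-sum lives on `EL` and equals the `L2` part of the left side minus the kind-2 mate terms
  have hB : ∑ i ∈ E, (b i : ℂ) * T i = ∑ i ∈ EL, (aX i : ℂ) * T i - ∑ u ∈ E₂, (aX u : ℂ) * T (m u) := by
    have hB1 : ∑ i ∈ E, (b i : ℂ) * T i = ∑ i ∈ EL, (b i : ℂ) * T i := by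
      rw [hEL, Finset.sum_filter_of_ne]
      intro i _ hbi
      by_contra hL
      rw [hbL i hL, Int.cast_zero, zero_mul] at hbi
      exact hbi rfl
    -- split `EL` into the mates of `E₂` and the rest
    have hmates : EL.filter (fun i => ∃ u, u ∈ U₂ ∧ m u = i) = E₂.image m := by
      ext i
      simp only [Finset.mem_filter, Finset.mem_image, hEL, hE₂]  -- names unfold
      constructor
      · rintro ⟨⟨hi, -⟩, u, hu, rfl⟩
        exact ⟨u, ⟨(hEm₂ u hu).2 hi, hu⟩, rfl⟩
      · rintro ⟨u, ⟨huE, hu⟩, rfl⟩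
        exact ⟨⟨(hEm₂ u hu).1 huE, (hU₂ u hu).2⟩, u, hu, rfl⟩
    have hinj : Set.InjOn m ↑E₂ := fun u hu u' hu' h => hm (Finset.mem_filter.1 hu).2 (Finset.mem_filter.1 hu').2 h
    have hBL : ∑ i ∈ EL, (b i : ℂ) * T i =
        ∑ i ∈ EL.filter (fun i => ∃ u, u ∈ U₂ ∧ m u = i), (b i : ℂ) * T i + ∑ i ∈ EL.filter (fun i => ¬ ∃ u, u ∈ U₂ ∧ m u = i), (b i : ℂ) * T i :=
      (Finset.sum_filter_add_sum_filter_not EL _ _).symm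
    have hAL : ∑ i ∈ EL, (aX i : ℂ) * T i =
        ∑ i ∈ EL.filter (fun i => ∃ u, u ∈ U₂ ∧ m u = i), (aX i : ℂ) * T i + ∑ i ∈ EL.filter (fun i => ¬ ∃ u, u ∈ U₂ ∧ m u = i), (aX i : ℂ) * T i :=
      (Finset.sum_filter_add_sum_filter_not EL _ _).symm
    have hrest : ∑ i ∈ EL.filter (fun i => ¬ ∃ u, u ∈ U₂ ∧ m u = i), (b i : ℂ) * T i =
        ∑ i ∈ EL.filter (fun i => ¬ ∃ u, u ∈ U₂ ∧ m u = i), (aX i : ℂ) * T i := by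
      refine Finset.sum_congr rfl fun i hi => ?_
      rw [Finset.mem_filter, hEL, Finset.mem_filter] at hi
      rw [hb₀ i hi.1.2 fun u hu hmu => hi.2 ⟨u, hu, hmu⟩]
    have hmate_b : ∑ i ∈ EL.filter (fun i => ∃ u, u ∈ U₂ ∧ m u = i), (b i : ℂ) * T i =
        ∑ u ∈ E₂, ((aX (m u) : ℂ) - aX u) * T (m u) := by
      rw [hmates, Finset.sum_image hinj]
      refine Finset.sum_congr rfl fun u hu => ?_
      rw [hb₂ u (Finset.mem_filter.1 hu).2, Int.cast_sub]
    have hmate_a : ∑ i ∈ EL.filter (fun i => ∃ u, u ∈ U₂ ∧ m u = i), (aX i : ℂ) * T i = ∑ u ∈ E₂, (aX (m u) : ℂ) * T (m u) := by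
      rw [hmates, Finset.sum_image hinj]
    rw [hB1, hBL, hAL, hrest, hmate_b, hmate_a]
    have : ∑ u ∈ E₂, ((aX (m u) : ℂ) - aX u) * T (m u) = ∑ u ∈ E₂, (aX (m u) : ℂ) * T (m u) - ∑ u ∈ E₂, (aX u : ℂ) * T (m u) := by
      rw [← Finset.sum_sub_distrib]
      exact Finset.sum_congr rfl fun u _ => by ring
    rw [this]; ring
  -- (3) the `d`-sum is the sum of `a u · P(par u)` over the oriented units of `E`
  have hD : ∑ lam ∈ EO.image par, (d lam : ℂ) * P lam = ∑ u ∈ E₁, (aX u : ℂ) * P (par u) + ∑ u ∈ E₂, (aX u : ℂ) * P (par u) +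
      ∑ u ∈ E₃r, (aX u : ℂ) * P (par u) := by
    have hinj : Set.InjOn par ↑EO := fun u hu u' hu' h => hpar (Finset.mem_filter.1 hu).2 (Finset.mem_filter.1 hu').2 h
    rw [Finset.sum_image hinj]
    have hEO' : EO = (E₁ ∪ E₂) ∪ E₃r := by
      ext u
      simp only [Finset.mem_filter, Finset.mem_union, hEO, hE₁, hE₂, hE₃r]
      tauto
    have hd12 : Disjoint E₁ E₂ := Finset.disjoint_filter.2 fun i _ h1 h2 => h12 i h1 h2
    have hd123 : Disjoint (E₁ ∪ E₂) E₃r := by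
      rw [Finset.disjoint_union_left]
      exact ⟨Finset.disjoint_filter.2 fun i _ h1 h3 => h13 i h1 h3.1, Finset.disjoint_filter.2 fun i _ h2 h3 => h23 i h2 h3.1⟩
    rw [hEO', Finset.sum_union hd123, Finset.sum_union hd12]
    refine congrArg₂ (· + ·) (congrArg₂ (· + ·) ?_ ?_) ?_
    · exact Finset.sum_congr rfl fun u hu => by rw [hd u (Or.inl (Finset.mem_filter.1 hu).2)]
    · exact Finset.sum_congr rfl fun u hu => by rw [hd u (Or.inr (Or.inl (Finset.mem_filter.1 hu).2))]
    · exact Finset.sum_congr rfl fun u hu => by rw [hd u (Or.inr (Or.inr (Finset.mem_filter.1 hu).2))]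
  -- (4) kind 1: `T u = P(par u)`
  have hK1 : ∑ u ∈ E₁, (aX u : ℂ) * T u = ∑ u ∈ E₁, (aX u : ℂ) * P (par u) :=
    Finset.sum_congr rfl fun u hu => by rw [hT₁ u (Finset.mem_filter.1 hu).2]
  -- (5) kind 2: `T u = P(par u) - T(m u)`
  have hK2 : ∑ u ∈ E₂, (aX u : ℂ) * T u = ∑ u ∈ E₂, (aX u : ℂ) * P (par u) - ∑ u ∈ E₂, (aX u : ℂ) * T (m u) := by
    rw [← Finset.sum_sub_distrib]
    exact Finset.sum_congr rfl fun u hu => by rw [← hT₂ u (Finset.mem_filter.1 hu).2]; ring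
  -- (6) kind 3: the non-oriented members are the mates of the oriented ones
  have hK3 : ∑ u ∈ E₃r, (aX u : ℂ) * T u + ∑ u ∈ E₃n, (aX u : ℂ) * T u = ∑ u ∈ E₃r, (aX u : ℂ) * P (par u) := by
    have himg : E₃n = E₃r.image m := by
      ext i
      simp only [Finset.mem_image, Finset.mem_filter, hE₃r, hE₃n]
      constructor
      · rintro ⟨hi, h3, hr⟩
        obtain ⟨-, hm3, hmm, -, -, -, hrep⟩ := hU₃ i h3
        refine ⟨m i, ⟨hEm₃ i h3 hi, hm3, ?_⟩, hmm⟩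
        have h' := (hU₃ (m i) hm3).2.2.2.2.2.2
        rw [hmm] at h'
        -- `rep (m i) ↔ ¬ rep (m (m i)) = ¬ rep i`
        exact h'.2 hr
      · rintro ⟨u, ⟨huE, hu3, hur⟩, rfl⟩
        obtain ⟨-, hm3, -, -, -, -, hrep⟩ := hU₃ u hu3
        exact ⟨hEm₃ u hu3 huE, hm3, hrep.1 hur⟩
    have hinj : Set.InjOn m ↑E₃r := by
      intro u hu u' hu' h
      have h3 := (Finset.mem_filter.1 hu).2.1
      have h3' := (Finset.mem_filter.1 hu').2.1
      rw [← (hU₃ u h3).2.2.1, ← (hU₃ u' h3').2.2.1, h]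
    rw [himg, Finset.sum_image hinj, ← Finset.sum_add_distrib]
    refine Finset.sum_congr rfl fun u hu => ?_
    have h3 := (Finset.mem_filter.1 hu).2.1
    rw [(hU₃ u h3).2.2.2.2.2.1, ← hT₃ u h3]
    ring
  -- (7) assemble
  rw [hLHS, hB, hD, hK1, hK2, hK3]
  ring

/-! ## §2 Enclosing a finite set of classes in a mate-closed finite set -/

/-- Every finite set `B` of classes is contained in a finite `E` closed under the kind-2 mates in both directions and under the kind-3 mates (take
`E = B ∪ m(B ∩ U₃) ∪ m(B ∩ U₂) ∪ (U₂ ∩ m⁻¹ B)`, finite because `m` is injective on `U₂`) — so the finitely many classes seen by a fixed test function can be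
enclosed in a set to which `regroup_sum_eq` applies. [cite: Rogawski1990, §12.7 Lemma 12.7.2 (proof) pp. 192–193] -/
theorem exists_closed_finset (L2 : I → Prop) (U₂ U₃ : Set I) (m : I → I) (hU₂ : ∀ u ∈ U₂, ¬ L2 u ∧ L2 (m u))
    (hU₃ : ∀ u ∈ U₃, ¬ L2 u ∧ m u ∈ U₃ ∧ m (m u) = u) (h23 : ∀ u ∈ U₂, u ∉ U₃) (hm : Set.InjOn m U₂) (B : Set I) (hB : B.Finite) :
    ∃ E : Finset I, B ⊆ ↑E ∧ (∀ u ∈ U₂, u ∈ E ↔ m u ∈ E) ∧ (∀ u ∈ U₃, u ∈ E → m u ∈ E) := by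
  classical
  have h4 : (U₂ ∩ m ⁻¹' B).Finite :=
    Set.Finite.of_finite_image (hB.subset (by rintro _ ⟨u, ⟨-, hu⟩, rfl⟩; exact hu)) (hm.mono Set.inter_subset_left)
  set S : Set I := ((B ∪ m '' (B ∩ U₃)) ∪ m '' (B ∩ U₂)) ∪ (U₂ ∩ m ⁻¹' B) with hS
  have hSf : S.Finite := (((hB.union ((hB.inter_of_left U₃).image m)).union ((hB.inter_of_left U₂).image m)).union h4)
  refine ⟨hSf.toFinset, fun i hi => ?_, fun u hu => ?_, fun u hu huE => ?_⟩
  · rw [Set.Finite.coe_toFinset]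
    exact Or.inl (Or.inl (Or.inl hi))
  · rw [Set.Finite.mem_toFinset, Set.Finite.mem_toFinset]
    constructor
    · rintro (((h | ⟨u', ⟨hu'B, hu'3⟩, hu'⟩) | ⟨u', ⟨hu'B, hu'2⟩, hu'⟩) | ⟨-, h⟩)
      · exact Or.inl (Or.inr ⟨u, ⟨h, hu⟩, rfl⟩)
      · exact absurd ((hu' ▸ (hU₃ u' hu'3).2.1 : u ∈ U₃)) (h23 u hu)
      · exact absurd (hu' ▸ (hU₂ u' hu'2).2 : L2 u) (hU₂ u hu).1
      · exact Or.inl (Or.inl (Or.inl h))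
    · rintro (((h | ⟨u', ⟨hu'B, hu'3⟩, hu'⟩) | ⟨u', ⟨hu'B, hu'2⟩, hu'⟩) | ⟨h, -⟩)
      · exact Or.inr ⟨hu, h⟩
      · exact absurd (hU₂ u hu).2 (hu' ▸ (hU₃ u' hu'3).2.1 |> fun h3 => (hU₃ (m u) h3).1)
      · have : u' = u := hm hu'2 hu hu'
        exact Or.inl (Or.inl (Or.inl (this ▸ hu'B)))
      · exact absurd (hU₂ u hu).2 (hU₂ (m u) h).1
  · rw [Set.Finite.mem_toFinset] at huE ⊢
    rcases huE with (((h | ⟨u', ⟨hu'B, hu'3⟩, hu'⟩) | ⟨u', ⟨-, hu'2⟩, hu'⟩) | ⟨h, -⟩)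
    · exact Or.inl (Or.inl (Or.inr ⟨u, ⟨h, hu⟩, rfl⟩))
    · refine Or.inl (Or.inl (Or.inl ?_))
      rw [← hu', (hU₃ u' hu'3).2.2]
      exact hu'B
    · exact absurd (hu' ▸ (hU₂ u' hu'2).2 : L2 u) (hU₃ u hu).1
    · exact absurd hu (h23 u h)

/-! ## §3 The re-grouped coefficients `b`, `d` and an orientation of the l.d.s. pairs exist -/

/-- **The coefficients of (12.7.1).**  Given `m` injective on the kind-2 units `U₂` (with `L2` mates) and `par` injective on the oriented units `O`, there are
`b : I → ℤ` — `0` off `L2`, `a(σ) − a(u)` at the mate `σ = m u` of a kind-2 unit `u`, `a(σ)` at the other `L2` classes — and `d : Λ → ℤ` with `d(par u) = a(u)` on `O` and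
`d = 0` off `par(O)`; with the support read-outs used for countability, provenance and the finiteness bookkeeping. [cite: Rogawski1990, §12.7 Lemma 12.7.2 (proof) p. 193] -/
theorem exists_coeffs (aX : I → ℤ) (L2 : I → Prop) (U₂ O : Set I) (m : I → I) (par : I → Λ) (hU₂ : ∀ u ∈ U₂, L2 (m u)) (hm : Set.InjOn m U₂)
    (hpar : Set.InjOn par O) :
    ∃ (b : I → ℤ) (d : Λ → ℤ),
      (∀ i, ¬ L2 i → b i = 0) ∧ (∀ u ∈ U₂, b (m u) = aX (m u) - aX u) ∧ (∀ i, L2 i → (∀ u ∈ U₂, m u ≠ i) → b i = aX i) ∧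
      (∀ u ∈ O, d (par u) = aX u) ∧ (∀ lam, d lam ≠ 0 → ∃ u ∈ O, par u = lam ∧ d lam = aX u) ∧
      (∀ i, b i ≠ 0 → L2 i ∧ (b i = aX i ∨ ∃ u ∈ U₂, m u = i ∧ b i = aX i - aX u)) := by
  classical
  refine ⟨fun i => if L2 i then aX i - (if h : ∃ u, u ∈ U₂ ∧ m u = i then aX (Classical.choose h) else 0) else 0,
    fun lam => if h : ∃ u, u ∈ O ∧ par u = lam then aX (Classical.choose h) else 0, ?_, ?_, ?_, ?_, ?_, ?_⟩
  · intro i hi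
    simp only [if_neg hi]
  · intro u hu
    have h : ∃ u', u' ∈ U₂ ∧ m u' = m u := ⟨u, hu, rfl⟩
    have hc : Classical.choose h = u := hm (Classical.choose_spec h).1 hu (Classical.choose_spec h).2
    simp only [if_pos (hU₂ u hu), dif_pos h, hc]
  · intro i hi hno
    have h : ¬ ∃ u', u' ∈ U₂ ∧ m u' = i := fun ⟨u', hu', he⟩ => hno u' hu' he
    simp only [if_pos hi, dif_neg h, sub_zero]
  · intro u hu
    have h : ∃ u', u' ∈ O ∧ par u' = par u := ⟨u, hu, rfl⟩
    have hc : Classical.choose h = u := hpar (Classical.choose_spec h).1 hu (Classical.choose_spec h).2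
    simp only [dif_pos h, hc]
  · intro lam hlam
    by_cases h : ∃ u', u' ∈ O ∧ par u' = lam
    · refine ⟨Classical.choose h, (Classical.choose_spec h).1, (Classical.choose_spec h).2, ?_⟩
      simp only [dif_pos h]
    · exact absurd (by simp only [dif_neg h]) hlam
  · intro i hbi
    by_cases hi : L2 i
    · refine ⟨hi, ?_⟩
      by_cases h : ∃ u', u' ∈ U₂ ∧ m u' = i
      · refine Or.inr ⟨Classical.choose h, (Classical.choose_spec h).1, (Classical.choose_spec h).2, ?_⟩
        simp only [if_pos hi, dif_pos h]
      · left
        simp only [if_pos hi, dif_neg h, sub_zero]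
    · exact absurd (by simp only [if_neg hi]) hbi

/-- **Orienting the l.d.s. pairs.**  For a fixed-point-free involution `m` on `U₃` there is a predicate `rep` holding at exactly one member of each pair `{u, m u}` (a
well-ordering of `I` decides). [cite: Rogawski1990, §12.7 Lemma 12.7.2 (proof) p. 192] -/
theorem exists_orientation (U₃ : Set I) (m : I → I) (hU₃ : ∀ u ∈ U₃, m (m u) = u ∧ m u ≠ u) :
    ∃ rep : I → Prop, ∀ u ∈ U₃, rep u ↔ ¬ rep (m u) := by
  refine ⟨fun u => WellOrderingRel u (m u), fun u hu => ?_⟩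
  obtain ⟨hmm, hne⟩ := hU₃ u hu
  show WellOrderingRel u (m u) ↔ ¬ WellOrderingRel (m u) (m (m u))
  rw [hmm]
  constructor
  · exact fun h h' => irrefl (r := WellOrderingRel) u (_root_.trans (r := WellOrderingRel) h h')
  · intro h
    rcases trichotomous (r := WellOrderingRel) u (m u) with h1 | h2 | h3
    · exact h1
    · exact absurd h2.symm hne
    · exact absurd h3 h

end Summit.HodgeConjecture.HodgeConjecture.Cruxes.H413.F0P3cStCharTSRegroupAlg
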